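import Mathlib.Combinatorics.SimpleGraph.Maps
import Mathlib.Data.Fintype.Card
import Mathlib.Data.Finset.Card
import Mathlib.Data.Fintype.Prod
import Literature.Combinatorics.SimpleGraph.ColouringSections
import HarnessLib

/-!
# The switching-equivalent graph of a colouring (Laubner 2011, Def. 3.3.2) and sections

Second step of the Corneil–Goldberg section machinery [CorneilGoldberg1984] in Laubner's
exposition [Laubner2011, §3.3.2], undirected simple-graph case. For a colouring `ρ` of `G`:

* `crossEdges G ρ c d` — the number of ordered pairs `(u, w)`, `ρ u = c`, `ρ w = d`, `u ~ w`;
  `cellCard ρ c`; `adjCount G ρ u d` — the neighbours of `u` of colour `d`.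
* `Switch G ρ c d : Prop` — the block `(c, d)` is SWITCHED: more than half of the pairs between
  the two colour classes are edges (`|P_c| |P_d| < 2 e(P_c, P_d)`; for an equitable colouring this
  is Laubner's per-vertex condition `n_{cd} > |P_d| / 2`, `switch_iff_of_isEquitable`). Symmetric.
* `swGraph G ρ` — the **switching-equivalent graph** `G_P`: complement `G` on every switched
  block (Def. 3.3.2); label-invariant (`swGraph_comap`).
* **Lemma 3.3.3** `isSection_swGraph_iff`: `H` is a section of `ρ` in `G_P` iff in `G` (here for
  every colouring — switching a whole block does not change "determined by the classes").
* **Proposition 3.3.4** `isSection_of_swClosed`: a set closed under `G_P`-adjacency (a union of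
  connected components of `G_P`) is a section of `ρ` in `G`.

## References

* B. Laubner, PhD thesis, HU Berlin 2011, doi:10.18452/16335, Def. 3.3.2, Lemma 3.3.3,
  Prop. 3.3.4; read pp. 45–46. [Laubner2011]
* D. G. Corneil, M. K. Goldberg, J. Algorithms 5 (1984) 345–362. [CorneilGoldberg1984]
-/

namespace Literature.Combinatorics.SimpleGraph

open _root_.SimpleGraph Finset

universe u

variable {V : Type u} [Fintype V] (G : _root_.SimpleGraph V) [DecidableRel G.Adj]
variable {κ : Type*} [DecidableEq κ] (ρ : V → κ)

/-! ## Counting between colour classes -/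

/-- The size of the colour class of `c`. [folklore] -/
def cellCard (c : κ) : ℕ := (univ.filter fun w => ρ w = c).card

/-- The number of neighbours of `u` of colour `d`. [cite: Laubner2011, Def. 3.2.7 (`n_{ij}`)] -/
def adjCount (u : V) (d : κ) : ℕ := (univ.filter fun w => G.Adj u w ∧ ρ w = d).card

/-- The number of ordered adjacent pairs from colour `c` to colour `d`. [cite: Laubner2011, §3.3.2 (Equation (N))] -/
def crossEdges (c d : κ) : ℕ := (univ.filter fun p : V × V => ρ p.1 = c ∧ ρ p.2 = d ∧ G.Adj p.1 p.2).card

variable {G ρ}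

/-- `crossEdges` is symmetric (adjacency is). [folklore] -/
theorem crossEdges_comm (c d : κ) : crossEdges G ρ c d = crossEdges G ρ d c := by
  unfold crossEdges
  refine card_equiv (Equiv.prodComm V V) fun p => ?_
  simp only [mem_filter, mem_univ, true_and, Equiv.prodComm_apply, Prod.fst_swap, Prod.snd_swap]
  constructor
  · rintro ⟨h₁, h₂, h₃⟩; exact ⟨h₂, h₁, h₃.symm⟩
  · rintro ⟨h₁, h₂, h₃⟩; exact ⟨h₂, h₁, h₃.symm⟩

/-- **Double counting (Equation (N))**: `e(P_c, P_d) = Σ_{u ∈ P_c} n_u(d)`. [cite: Laubner2011, §3.3.2 (N)] -/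
theorem crossEdges_eq_sum (c d : κ) :
    crossEdges G ρ c d = ∑ u ∈ univ.filter (fun w => ρ w = c), adjCount G ρ u d := by
  unfold crossEdges adjCount
  rw [card_filter, ← univ_product_univ, sum_product, sum_filter]
  refine sum_congr rfl fun u _ => ?_
  rw [card_filter]
  split_ifs with hu
  · refine sum_congr rfl fun w _ => ?_
    by_cases h₁ : G.Adj u w <;> by_cases h₂ : ρ w = d <;> simp [hu, h₁, h₂]
  · exact sum_eq_zero fun w _ => by simp [hu]

/-- Counting with a finset. [folklore] -/
private theorem natCard_subtype' (p : V → Prop) [DecidablePred p] :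
    Nat.card {w : V // p w} = (univ.filter p).card := by
  rw [Nat.card_eq_fintype_card, Fintype.card_subtype]

/-- For an EQUITABLE colouring all `u ∈ P_c` have the same `n_u(d)`. [cite: Laubner2011, Def. 3.2.7] -/
theorem IsEquitable.adjCount_eq (hρ : IsEquitable G ρ) {u w : V} (h : ρ u = ρ w) (d : κ) :
    adjCount G ρ u d = adjCount G ρ w d := by
  have := hρ u w h d
  rwa [natCard_subtype', natCard_subtype'] at this

/-- For an EQUITABLE colouring, `e(P_c, P_d) = |P_c| · n_u(d)` for any `u ∈ P_c`. [cite: Laubner2011, §3.3.2 (N)] -/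
theorem IsEquitable.crossEdges_eq (hρ : IsEquitable G ρ) {u : V} (d : κ) :
    crossEdges G ρ (ρ u) d = cellCard ρ (ρ u) * adjCount G ρ u d := by
  rw [crossEdges_eq_sum, sum_congr rfl fun w hw => hρ.adjCount_eq (mem_filter.1 hw).2 d, sum_const,
    smul_eq_mul]
  rfl

/-! ## Switched blocks and the switching-equivalent graph -/

variable (G ρ)

/-- The block `(c, d)` is **switched**: more than half of the pairs between the classes of `c` and
`d` are edges. [cite: Laubner2011, Def. 3.3.2] -/
def Switch (c d : κ) : Prop := cellCard ρ c * cellCard ρ d < 2 * crossEdges G ρ c d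

/-- Switching is decidable (a finite count). [folklore] -/
instance Switch.decidable (c d : κ) : Decidable (Switch G ρ c d) := by
  unfold Switch; infer_instance

variable {G ρ}

/-- Switching is symmetric. [folklore] -/
theorem switch_comm (c d : κ) : Switch G ρ c d ↔ Switch G ρ d c := by
  unfold Switch
  rw [crossEdges_comm, Nat.mul_comm]

/-- For an equitable colouring, `(ρ u, d)` is switched iff `u` has more than `|P_d| / 2` neighbours
of colour `d` — Laubner's `n_{ij} > |P_j| / 2`. [cite: Laubner2011, Def. 3.3.2] -/
theorem switch_iff_of_isEquitable (hρ : IsEquitable G ρ) (u : V) (d : κ) :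
    Switch G ρ (ρ u) d ↔ cellCard ρ d < 2 * adjCount G ρ u d := by
  unfold Switch
  rw [hρ.crossEdges_eq, Nat.mul_left_comm]
  exact Nat.mul_lt_mul_left (card_pos.2 ⟨u, by simp⟩)

variable (G ρ)

/-- **The switching-equivalent graph** `G_P`: complement the adjacency on every switched block.
[cite: Laubner2011, Def. 3.3.2] -/
def swGraph : _root_.SimpleGraph V where
  Adj u v := u ≠ v ∧ (G.Adj u v ↔ ¬ Switch G ρ (ρ u) (ρ v))
  symm := ⟨fun u v h => ⟨h.1.symm, by rw [G.adj_comm, switch_comm]; exact h.2⟩⟩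
  loopless := ⟨fun u h => h.1 rfl⟩

/-- Adjacency in `G_P` is decidable. [folklore] -/
instance swGraph.decidableRel [DecidableEq V] : DecidableRel (swGraph G ρ).Adj := fun u v =>
  show Decidable (u ≠ v ∧ (G.Adj u v ↔ ¬ Switch G ρ (ρ u) (ρ v))) from inferInstance

variable {G ρ}

/-- Unfolding `swGraph`. [folklore] -/
theorem swGraph_adj {u v : V} : (swGraph G ρ).Adj u v ↔ u ≠ v ∧ (G.Adj u v ↔ ¬ Switch G ρ (ρ u) (ρ v)) :=
  Iff.rfl

/-- Off a switched block `G_P` agrees with `G`; on a switched block it is the complement. [cite: Laubner2011, Def. 3.3.2] -/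
theorem swGraph_adj_of_ne {u v : V} (hne : u ≠ v) :
    (swGraph G ρ).Adj u v ↔ (G.Adj u v ↔ ¬ Switch G ρ (ρ u) (ρ v)) := by
  rw [swGraph_adj]
  exact ⟨fun h => h.2, fun h => ⟨hne, h⟩⟩

/-! ## Lemma 3.3.3 and Proposition 3.3.4 -/

/-- **Lemma 3.3.3**: `H` is a section of `ρ` in the switching-equivalent graph iff it is one in `G`
(switching whole blocks does not affect whether crossing adjacency is determined by the classes;
true for every colouring). [cite: Laubner2011, Lemma 3.3.3] -/
theorem isSection_swGraph_iff (H : Set V) : IsSection (swGraph G ρ) ρ H ↔ IsSection G ρ H := by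
  constructor
  · intro h u u' v v' hu hv huu' hvv' hcross
    have hne : u ≠ v := fun e => hcross (by rw [e])
    have hne' : u' ≠ v' := fun e => hcross (by rw [huu', e, ← hvv'])
    have h' := h hu hv huu' hvv' hcross
    rw [swGraph_adj_of_ne hne, swGraph_adj_of_ne hne', hu, hv] at h'
    by_cases hs : Switch G ρ (ρ u') (ρ v') <;> simp only [hs, not_true, not_false_iff, iff_false, iff_true] at h' <;>
      tauto
  · intro h u u' v v' hu hv huu' hvv' hcross
    have hne : u ≠ v := fun e => hcross (by rw [e])
    have hne' : u' ≠ v' := fun e => hcross (by rw [huu', e, ← hvv'])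
    have h' := h hu hv huu' hvv' hcross
    rw [swGraph_adj_of_ne hne, swGraph_adj_of_ne hne', hu, hv, h']

/-- **Proposition 3.3.4**: a set closed under `G_P`-adjacency (a union of connected components of
the switching-equivalent graph) is a section of `ρ` in `G`. [cite: Laubner2011, Prop. 3.3.4] -/
theorem isSection_of_swClosed {C : Set V} (hC : ∀ ⦃u v : V⦄, u ∈ C → (swGraph G ρ).Adj u v → v ∈ C) :
    IsSection G ρ C := by
  -- across `C` there are no `G_P`-edges, so `G`-adjacency across `C` is the switch bit of the colours
  have key : ∀ {u v : V}, ¬ (u ∈ C ↔ v ∈ C) → (G.Adj u v ↔ Switch G ρ (ρ u) (ρ v)) := by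
    intro u v hcross
    have hne : u ≠ v := fun e => hcross (by rw [e])
    have hnadj : ¬ (swGraph G ρ).Adj u v := by
      intro hadj
      by_cases hu : u ∈ C
      · exact hcross (iff_of_true hu (hC hu hadj))
      · exact hu (hC (by_contra fun hv => hcross (iff_of_false hu hv)) hadj.symm)
    rw [swGraph_adj_of_ne hne] at hnadj
    tauto
  intro u u' v v' hu hv huu' hvv' hcross
  have hcross' : ¬ (u' ∈ C ↔ v' ∈ C) := fun h => hcross (huu'.trans (h.trans hvv'.symm))
  rw [key hcross, key hcross', hu, hv]

/-! ## Label-invariance -/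

omit [DecidableRel G.Adj] in
/-- Colour-class sizes are label-invariant. [folklore] -/
theorem cellCard_comp {W : Type*} [Fintype W] (e : W ≃ V) (c : κ) :
    cellCard (ρ ∘ e) c = cellCard ρ c := by
  unfold cellCard
  exact card_equiv e fun w => by simp

/-- Cross-edge counts are label-invariant. [folklore] -/
theorem crossEdges_comap {W : Type*} [Fintype W] (e : W ≃ V) [DecidableRel (G.comap e).Adj] (c d : κ) :
    crossEdges (G.comap e) (ρ ∘ e) c d = crossEdges G ρ c d := by
  unfold crossEdges
  exact card_equiv (Equiv.prodCongr e e) fun p => by simp [SimpleGraph.comap_adj]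

/-- Switching is label-invariant. [folklore] -/
theorem switch_comap_iff {W : Type*} [Fintype W] (e : W ≃ V) [DecidableRel (G.comap e).Adj] (c d : κ) :
    Switch (G.comap e) (ρ ∘ e) c d ↔ Switch G ρ c d := by
  unfold Switch
  rw [cellCard_comp, cellCard_comp, crossEdges_comap]

/-- **The switching-equivalent graph is label-invariant**: `(G.comap e)_{ρ ∘ e} = (G_ρ).comap e`.
[cite: Laubner2011, §3.3.2] -/
theorem swGraph_comap {W : Type*} [Fintype W] (e : W ≃ V) [DecidableRel (G.comap e).Adj] :
    swGraph (G.comap e) (ρ ∘ e) = (swGraph G ρ).comap e := by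
  ext u v
  simp only [swGraph_adj, SimpleGraph.comap_adj, Function.comp_apply, switch_comap_iff, e.injective.ne_iff]

end Literature.Combinatorics.SimpleGraph
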